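import Mathlib

/-!
# `MatrixDescartes` (stmt-ValiantsHypothesis-18050) — the DEFINITE-MOMENTS LAW, sign-word form: bookkeeping of the point
# sequence `u, t₀, …, t_N, M′` and of the changing-gap count

HONEST FRAMING.  Cell `pub-symmetroid`, seat `val-sym-mdr-p2` (gen 14); helper file `--supports` the crux
`Theses.LacunarySymmetroid.MatrixDescartes`, NO closure claim; pure real/finset bookkeeping for `…DefiniteMomentsWordZeros`
(re-cut of `…DefiniteMomentsWordData`, whose hub build lagged).  No pencil appears here; nothing bears on the crux, the doors,
registers, or `VP ≠ VNP`.  [folklore]; axioms standard; no definitions.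
-/

-- layout Summits/ValiantsHypothesis/ValiantsHypothesis forces the duplicated namespace component
set_option linter.dupNamespace false

namespace Summit.ValiantsHypothesis.ValiantsHypothesis.Theorems.LacunarySymmetroidMatrixDescartes

open Finset
open scoped BigOperators

namespace DefiniteMoments

/-- **The point sequence.**  Given scales `t₀ < ⋯ < t_N`, a point `u < t₀` and a point `M′ > t_N`, there is a strictly
increasing `q : Fin (N+3) → ℝ` with `q₀ = u`, `q_{j+1} = tⱼ`, `q_{N+2} = M′`. [folklore] -/
theorem exists_wordPoints {N : ℕ} (t : Fin (N + 1) → ℝ) (ht : StrictMono t) (u M' : ℝ) (hut : u < t 0)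
    (hM't : t (Fin.last N) < M') :
    ∃ q : Fin (N + 2 + 1) → ℝ, StrictMono q ∧ (∀ i : Fin (N + 2 + 1), (i : ℕ) = 0 → q i = u) ∧
      (∀ (i : Fin (N + 2 + 1)) (j : Fin (N + 1)), (i : ℕ) = (j : ℕ) + 1 → q i = t j) ∧
      (∀ i : Fin (N + 2 + 1), (i : ℕ) = N + 2 → q i = M') := by
  obtain ⟨q, hq_u, hq_t, hq_M⟩ : ∃ q : Fin (N + 2 + 1) → ℝ, (∀ i : Fin (N + 2 + 1), (i : ℕ) = 0 → q i = u) ∧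
      (∀ (i : Fin (N + 2 + 1)) (j : Fin (N + 1)), (i : ℕ) = (j : ℕ) + 1 → q i = t j) ∧
      (∀ i : Fin (N + 2 + 1), (i : ℕ) = N + 2 → q i = M') := by
    refine ⟨fun i : Fin (N + 2 + 1) =>
        if (i : ℕ) = 0 then u else if h : (i : ℕ) ≤ N + 1 then t ⟨(i : ℕ) - 1, by omega⟩ else M',
      fun i hi => by simp only [hi]; rfl, fun i j hij => ?_, fun i hi => ?_⟩
    · have h1 : ¬ ((i : ℕ) = 0) := by omega
      have h2 : (i : ℕ) ≤ N + 1 := by have := j.isLt; omega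
      simp only [h1, h2, if_false, dif_pos]
      congr 1
      ext
      simp only [hij, Nat.add_sub_cancel]
    · have h1 : ¬ ((i : ℕ) = 0) := by omega
      have h2 : ¬ ((i : ℕ) ≤ N + 1) := by omega
      simp only [h1, h2]
      rfl
  refine ⟨q, ?_, hq_u, hq_t, hq_M⟩
  refine Fin.strictMono_iff_lt_succ.2 fun i => ?_
  have hi := i.isLt
  rcases Nat.eq_zero_or_pos (i : ℕ) with h0 | hpos
  · rw [hq_u i.castSucc (by simp [h0]), hq_t i.succ 0 (by simp [h0])]
    exact hut
  · rcases Nat.lt_or_ge (i : ℕ) (N + 1) with hlt | hge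
    · rw [hq_t i.castSucc ⟨(i : ℕ) - 1, by omega⟩ (by simp; omega), hq_t i.succ ⟨(i : ℕ), by omega⟩ (by simp)]
      exact ht (Fin.mk_lt_mk.2 (by omega))
    · have hiN : (i : ℕ) = N + 1 := by omega
      rw [hq_t i.castSucc (Fin.last N) (by simp [hiN]), hq_M i.succ (by simp [hiN])]
      exact hM't

/-- **The changing-gap count.**  For a predicate on `Fin (N+2)` holding at every index `1 ≤ i ≤ N`, and also at `0` if
`c₀` holds and at `N+1` if `c₁` holds: the count is at least `N + [c₀] + [c₁]`, stated in the form used by the budget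
accounting — `b₁ ≤ #{changing} + b₀` whenever `b₁ ≤ N + 2`, `b₀ = 0 → c₀`, `b₁ = N + 2 → c₁`. [folklore] -/
theorem changingGaps_bound {N : ℕ} (chg : Fin (N + 2) → Prop) [DecidablePred chg]
    (hmid : ∀ i : Fin (N + 2), 1 ≤ (i : ℕ) → (i : ℕ) ≤ N → chg i) (b₀ b₁ : ℕ) (hb₁ : b₁ ≤ N + 2)
    (h0 : b₀ = 0 → chg 0) (hL : b₁ = N + 2 → chg (Fin.last (N + 1))) :
    b₁ ≤ ((Finset.univ : Finset (Fin (N + 2))).filter chg).card + b₀ := by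
  set CH := (Finset.univ : Finset (Fin (N + 2))).filter chg with hCH
  set mid := (Finset.univ : Finset (Fin (N + 2))).filter (fun i : Fin (N + 2) => 1 ≤ (i : ℕ) ∧ (i : ℕ) ≤ N)
    with hmid'
  have hmidN : N ≤ mid.card := by
    have h := Finset.card_le_card_of_injOn (s := (Finset.univ : Finset (Fin N))) (t := mid)
      (fun i : Fin N => (⟨(i : ℕ) + 1, by omega⟩ : Fin (N + 2)))
      (fun i _ => by
        rw [Finset.mem_coe, hmid', Finset.mem_filter]
        exact ⟨Finset.mem_univ _, by simp, Nat.succ_le_of_lt i.isLt⟩)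
      (fun i _ i' _ h => by
        have h' : (i : ℕ) + 1 = (i' : ℕ) + 1 := congrArg Fin.val h
        exact Fin.ext (by omega))
    rwa [Finset.card_univ, Fintype.card_fin] at h
  have hmid_sub : mid ⊆ CH := by
    intro i hi
    rw [hmid', Finset.mem_filter] at hi
    exact Finset.mem_filter.2 ⟨Finset.mem_univ _, hmid i hi.2.1 hi.2.2⟩
  have h0nm : (0 : Fin (N + 2)) ∉ mid := by rw [hmid', Finset.mem_filter]; simp
  have hLnm : Fin.last (N + 1) ∉ mid := by rw [hmid', Finset.mem_filter]; simp
  have hLn0 : Fin.last (N + 1) ∉ insert (0 : Fin (N + 2)) mid := by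
    rw [Finset.mem_insert, not_or]
    exact ⟨fun h => by have := congrArg Fin.val h; simp at this, hLnm⟩
  by_cases hb0 : b₀ = 0 <;> by_cases hbL : b₁ = N + 2
  · have hsub : insert (Fin.last (N + 1)) (insert (0 : Fin (N + 2)) mid) ⊆ CH := by
      intro i hi
      rw [Finset.mem_insert, Finset.mem_insert] at hi
      rcases hi with rfl | rfl | hi
      · exact Finset.mem_filter.2 ⟨Finset.mem_univ _, hL hbL⟩
      · exact Finset.mem_filter.2 ⟨Finset.mem_univ _, h0 hb0⟩
      · exact hmid_sub hi
    have h := Finset.card_le_card hsub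
    rw [Finset.card_insert_of_notMem hLn0, Finset.card_insert_of_notMem h0nm] at h
    omega
  · have hsub : insert (0 : Fin (N + 2)) mid ⊆ CH := by
      intro i hi
      rw [Finset.mem_insert] at hi
      rcases hi with rfl | hi
      · exact Finset.mem_filter.2 ⟨Finset.mem_univ _, h0 hb0⟩
      · exact hmid_sub hi
    have h := Finset.card_le_card hsub
    rw [Finset.card_insert_of_notMem h0nm] at h
    omega
  · have hsub : insert (Fin.last (N + 1)) mid ⊆ CH := by
      intro i hi
      rw [Finset.mem_insert] at hi
      rcases hi with rfl | hi
      · exact Finset.mem_filter.2 ⟨Finset.mem_univ _, hL hbL⟩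
      · exact hmid_sub hi
    have h := Finset.card_le_card hsub
    rw [Finset.card_insert_of_notMem hLnm] at h
    omega
  · have h := Finset.card_le_card hmid_sub
    omega

end DefiniteMoments

end Summit.ValiantsHypothesis.ValiantsHypothesis.Theorems.LacunarySymmetroidMatrixDescartes
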